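import Literature.AlgebraicGeometry.HodgeTheory.SpecialisedHypersurfaceFamilyPoints
import Literature.AlgebraicGeometry.HodgeTheory.DworkFamilyComplexPoints
import Literature.AlgebraicGeometry.HodgeTheory.MotivatedClassesDeformationInputs
import Literature.AlgebraicGeometry.Motives.MonomialSupportedHypersurfaceSymmetry
import HarnessLib

/-!
# The Dwork sextic pencil `X_ψ : Σ xᵢ⁶ − 6ψ ∏ xᵢ = 0`, `ψ⁶ ≠ 1`, as a smooth projective family over
# `𝔸¹ ∖ μ₆` (Katz 2009, §3: "the family `𝕏/𝔸¹[1/(λ^d − 1)]`")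

Family `hodge`, layer `Literature/AlgebraicGeometry/HodgeTheory` (namespace `DworkSextic`). Written for the
crux `GenericInvariantHodgeClasses` (stmt-HodgeConjecture-24129) of route
`HodgeConjecture/DworkReflectionQuotients`, whose analytic inputs (holomorphy of the Hodge bundle `F²𝓗⁴`
and Griffiths' infinitesimal variation along the pencil, Voisin I Thm. 10.3 / II Lemma 5.13, Thm. 6.13)
are statements about ONE-PARAMETER flat families of classes; they need the pencil as an honest family of
`ℂ`-schemes `π : 𝒳 → D`, `D = 𝔸¹ ∖ μ₆`, not only its members `X_ψ = DworkSextic.fibre ψ`.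

The construction is the tree's specialised sub-family of the universal smooth sextic
(`Motives/SpecialisedHypersurfaceFamily`, `familySpz`): the coefficient specialisation
`φ : ℂ[a_m | |m| = 6] → ℂ[b]`, `a_{6eᵢ} ↦ 1`, `a_{(1,…,1)} ↦ −6b`, all other `a_m ↦ 0`
(`DworkSextic.pencilSpz`), i.e. the affine line `b ↦ Σ xᵢ⁶ − 6b ∏ xᵢ` in the space of sextic forms;
`DworkSextic.pencil = familySpz ℂ 4 6 pencilSpz : 𝒳 ⟶ D` is the base change of the universal family to
the open set `D ⊆ 𝔸¹` of parameters with nonsingular form.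

* `DworkSextic.pencilSpz`, `DworkSextic.pencil`; `evalAt_comp_pencilSpz`: the Dwork form `F_ψ` belongs
  to the sub-family through `b ↦ ψ`; `DworkSextic.pencilPoint hψ : D(ℂ)` — the point `[F_ψ]` for `ψ⁶ ≠ 1`.
* `pointFormSpz_pencilPoint` (`F_{[F_ψ]} = F_ψ`), `pencilPoint_injective`, and
  **`exists_eq_pencilPoint`: every complex point of `D` is `[F_ψ]` for a unique `ψ` with `ψ⁶ ≠ 1`**
  (the form of a point `t` is `F_{t(b)}`, nonsingular iff `t(b)⁶ ≠ 1`, Katz Lemma 2.1 and its converse).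
* `isSmoothProjectiveFamily_pencil` (relative dimension `4`); **`exists_fiberIso_pencil`**: the fibre
  over `t` is the hypersurface of its form, compatibly with the embeddings into `ℙ⁵`
  (in particular `𝒳_{[F_ψ]} ≅ X_ψ`, `exists_fiberIso_pencilPoint`);
* **`isHomotopicallyLocallyTrivialOn_pencil`**: Ehresmann — every point of `D(ℂ)` has arbitrarily small
  open neighbourhoods `B` over which each fibre inclusion `𝒳_t(ℂ) ↪ π⁻¹B(ℂ)` is a homotopy equivalence
  (the tree's `isHomotopicallyLocallyTrivialOn_univ`; the base is quasi-compact as an open of the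
  Noetherian `𝔸¹`), hence `isCohomologicallyLocallyTrivialOn_pencil`.

## References

* [Katz2009] N. M. Katz, Another look at the Dwork family, Progr. Math. 270 (2009), §2 Lemma 2.1, §3
  ("over `R₀[1/(d ∏ wᵢ)]` the family is smooth over `𝔸¹[1/(λ^d − 1)]`").
* [VoisinHodgeII2003] C. Voisin, Hodge Theory and Complex Algebraic Geometry II (2003), §6.2.1.
* [VoisinHodgeI2002] C. Voisin, Hodge Theory and Complex Algebraic Geometry I (2002), Thm. 9.3, §9.2.1.
-/

noncomputable section

open CategoryTheory AlgebraicGeometry MvPolynomial Limits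
open scoped BigOperators

namespace Literature.AlgebraicGeometry.HodgeTheory.DworkSextic

open Literature.AlgebraicGeometry.Motives Literature.AlgebraicGeometry.Motives.UniversalHypersurface
open Literature.AlgebraicGeometry.HodgeTheory.UniversalHypersurface

/-! ### §1 The coefficient specialisation of the pencil and its points -/

/-- The coefficients of the pencil `b ↦ Σ xᵢ⁶ − 6b ∏ xᵢ` as polynomials in the parameter `b`:
`a_{6eᵢ} ↦ 1`, `a_{(1,…,1)} ↦ −6b`, every other degree-`6` coefficient `↦ 0`. [cite: Katz2009, §3] -/
def pencilCoeff (m : DegIndex 4 6) : MvPolynomial Unit ℂ :=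
  if (∃ i : Fin 6, (m.1 : Fin (4 + 2) →₀ ℕ) = Finsupp.single i 6) then 1
  else if (m.1 : Fin (4 + 2) →₀ ℕ) = ∑ l : Fin 6, Finsupp.single l 1 then C (-6) * X () else 0

/-- **The coefficient specialisation `φ : ℂ[a_m | |m| = 6] →ₐ ℂ[b]` of the Dwork pencil** (comorphism of
the affine line `𝔸¹ → S⁶`, `b ↦ Σ xᵢ⁶ − 6b ∏ xᵢ`, in the space of sextic forms). [cite: Katz2009, §3] -/
def pencilSpz : CoeffRing ℂ 4 6 →ₐ[ℂ] MvPolynomial Unit ℂ :=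
  MvPolynomial.aeval pencilCoeff

/-- **The Dwork sextic pencil as a smooth projective family `π : 𝒳 ⟶ D` over `D = 𝔸¹ ∖ μ₆`**: the
specialised sub-family of the universal smooth sextic fourfold along `pencilSpz` (base = parameters `b`
with `Σ xᵢ⁶ − 6b ∏ xᵢ` nonsingular, i.e. `b⁶ ≠ 1`). [cite: Katz2009, §3] [cite: VoisinHodgeII2003, §6.2.1] -/
abbrev pencil : totalSpz ℂ 4 6 pencilSpz ⟶ baseSpz ℂ 4 6 pencilSpz :=
  familySpz ℂ 4 6 pencilSpz

/-- Evaluation `ℂ[b] →ₐ ℂ`, `b ↦ ψ`. [folklore] -/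
abbrev evalAt (ψ : ℂ) : MvPolynomial Unit ℂ →ₐ[ℂ] ℂ :=
  MvPolynomial.aeval fun _ => ψ

/-- The coefficient of `Σ xᵢ⁶` at a degree-`6` exponent. [folklore] -/
private theorem coeff_sum_X_pow_six (m : Fin (4 + 2) →₀ ℕ) :
    coeff m (∑ i : Fin 6, (X i : MvPolynomial (Fin 6) ℂ) ^ 6) =
      if (∃ i : Fin 6, m = Finsupp.single i 6) then 1 else 0 := by
  classical
  rw [coeff_sum]
  simp_rw [X_pow_eq_monomial, coeff_monomial]
  by_cases h : ∃ i : Fin 6, m = Finsupp.single i 6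
  · obtain ⟨i, rfl⟩ := h
    rw [if_pos ⟨i, rfl⟩, Finset.sum_eq_single i (fun j _ hji => if_neg fun hij =>
      hji (Finsupp.single_left_injective (by norm_num) hij)) (fun hi => absurd (Finset.mem_univ i) hi),
      if_pos rfl]
  · rw [if_neg h]
    exact Finset.sum_eq_zero fun i _ => if_neg fun hi => h ⟨i, hi.symm⟩

/-- **The coefficients of the Dwork form**: `coeff_m F_ψ = 1` at `m = 6eᵢ`, `= −6ψ` at `m = (1,…,1)`,
`= 0` otherwise — i.e. `coeff_m F_ψ = pencilCoeff m` evaluated at `b = ψ`. [cite: Katz2009, §3] -/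
theorem evalAt_pencilCoeff (ψ : ℂ) (m : DegIndex 4 6) :
    evalAt ψ (pencilCoeff m) = coeff m.1 (form ψ) := by
  classical
  have hform : coeff m.1 (form ψ) =
      coeff m.1 (∑ i : Fin 6, (X i : MvPolynomial (Fin 6) ℂ) ^ 6) -
        6 * ψ * coeff m.1 (∏ i : Fin 6, (X i : MvPolynomial (Fin 6) ℂ)) := by
    show coeff m.1 ((∑ i : Fin 6, (X i : MvPolynomial (Fin 6) ℂ) ^ 6) - C (6 * ψ) * ∏ i : Fin 6, X i) = _
    rw [coeff_sub, coeff_C_mul]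
  rw [hform, coeff_sum_X_pow_six, prod_X_eq_monomial, coeff_monomial, pencilCoeff]
  by_cases h1 : ∃ i : Fin 6, (m.1 : Fin (4 + 2) →₀ ℕ) = Finsupp.single i 6
  · have hne : ¬ (∑ l : Fin 6, Finsupp.single l 1 : Fin 6 →₀ ℕ) = m.1 := by
      obtain ⟨i, hi⟩ := h1
      intro h
      have h6 : (∑ l : Fin 6, Finsupp.single l 1 : Fin 6 →₀ ℕ) i = (Finsupp.single i 6 : Fin 6 →₀ ℕ) i := by
        rw [h, hi]
      rw [Finsupp.finsetSum_apply, Finset.sum_eq_single i (fun l _ hl => by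
        rw [Finsupp.single_apply, if_neg hl]) (fun h => absurd (Finset.mem_univ i) h),
        Finsupp.single_eq_same, Finsupp.single_eq_same] at h6
      omega
    rw [if_pos h1, if_pos h1, if_neg hne, map_one]
    ring
  · rw [if_neg h1, if_neg h1]
    by_cases h2 : (m.1 : Fin (4 + 2) →₀ ℕ) = ∑ l : Fin 6, Finsupp.single l 1
    · rw [if_pos h2, if_pos h2.symm, map_mul, aeval_C, aeval_X]
      simp
    · rw [if_neg h2, if_neg (fun h => h2 h.symm), map_zero]
      ring

/-- **The Dwork form `F_ψ` belongs to the pencil through `b ↦ ψ`**: `ev_ψ ∘ φ = coeffHom F_ψ`.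
[cite: Katz2009, §3] -/
theorem evalAt_comp_pencilSpz (ψ : ℂ) : (evalAt ψ).comp pencilSpz = coeffHom ℂ 4 6 (form ψ) := by
  refine MvPolynomial.algHom_ext fun m => ?_
  rw [AlgHom.comp_apply, pencilSpz, aeval_X, evalAt_pencilCoeff, aeval_X]

variable {ψ : ℂ}

/-- **The point `[F_ψ] ∈ D(ℂ)` of the pencil**, for `ψ⁶ ≠ 1` (then `F_ψ` is nonsingular, Katz Lemma 2.1).
[cite: Katz2009, Lemma 2.1 and §3] -/
def pencilPoint (hψ : ψ ^ 6 ≠ 1) : AlgPoints (baseSpz ℂ 4 6 pencilSpz) ℂ :=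
  pointOfFormSpz ℂ 4 6 pencilSpz (isHomogeneous_form ψ) (isNonsingularForm_form hψ) (evalAt_comp_pencilSpz ψ)

/-- The form of the point `[F_ψ]` is `F_ψ`. [cite: VoisinHodgeII2003, §6.2.1] -/
theorem pointFormSpz_pencilPoint (hψ : ψ ^ 6 ≠ 1) :
    pointFormSpz ℂ 4 6 pencilSpz (pencilPoint hψ) = form ψ :=
  pointFormSpz_pointOfFormSpz ℂ 4 6 pencilSpz _ _ _

/-- The coefficient homomorphism of `[F_ψ]` is `b ↦ ψ`. [cite: VoisinHodgeII2003, §6.2.1] -/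
theorem pointHomSpz_pencilPoint (hψ : ψ ^ 6 ≠ 1) :
    pointHomSpz ℂ 4 6 pencilSpz (pencilPoint hψ) = CommRingCat.ofHom (evalAt ψ).toRingHom :=
  pointHomSpz_pointOfFormSpz ℂ 4 6 pencilSpz _ _ _

/-- **`ψ ↦ [F_ψ]` is injective** (the coefficient homomorphism `b ↦ ψ` recovers `ψ`). [cite: Katz2009, §3] -/
theorem pencilPoint_injective {ψ ψ' : ℂ} (hψ : ψ ^ 6 ≠ 1) (hψ' : ψ' ^ 6 ≠ 1)
    (h : pencilPoint hψ = pencilPoint hψ') : ψ = ψ' := by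
  have h1 := congrArg (pointHomSpz ℂ 4 6 pencilSpz) h
  rw [pointHomSpz_pencilPoint, pointHomSpz_pencilPoint] at h1
  have h2 := congrArg (fun f : CommRingCat.of (MvPolynomial Unit ℂ) ⟶ CommRingCat.of ℂ => f.hom (X ())) h1
  simpa using h2

/-- **Every complex point of `D` is `[F_ψ]` for some `ψ` with `ψ⁶ ≠ 1`**: the form of `t` is
`Σ xᵢ⁶ − 6·t(b)·∏ xᵢ = F_{t(b)}` (its coefficients factor through `φ`), it is nonsingular, so `t(b)⁶ ≠ 1`
(converse of Katz Lemma 2.1: `(1,…,1,ψ⁻¹)` is singular on `F_ψ` when `ψ⁶ = 1`), and a point of `D` is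
determined by its coefficient homomorphism. [cite: Katz2009, Lemma 2.1 and §3] [cite: VoisinHodgeII2003, §6.2.1] -/
theorem exists_eq_pencilPoint (t : AlgPoints (baseSpz ℂ 4 6 pencilSpz) ℂ) :
    ∃ (ψ : ℂ) (hψ : ψ ^ 6 ≠ 1), pencilPoint hψ = t := by
  set ψ : ℂ := pointAlgHomSpz ℂ 4 6 pencilSpz t (X ()) with hψdef
  have hev : pointAlgHomSpz ℂ 4 6 pencilSpz t = evalAt ψ :=
    MvPolynomial.algHom_ext fun u => by cases u; rw [aeval_X]
  -- the form of `t` is `F_ψ`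
  have hform : pointFormSpz ℂ 4 6 pencilSpz t = form ψ := by
    apply MvPolynomial.ext
    intro m
    by_cases hm : m.degree = 6
    · have h1 := coeff_pointFormSpz ℂ 4 6 pencilSpz t ⟨m, hm⟩
      rw [h1, ← pointAlgHomSpz_apply, hev, ← evalAt_pencilCoeff ψ ⟨m, hm⟩, pencilSpz, aeval_X]
    · rw [(isHomogeneous_pointForm ℂ 4 6 _).coeff_eq_zero hm, (isHomogeneous_form ψ).coeff_eq_zero hm]
  -- hence `ψ⁶ ≠ 1`
  have hψ : ψ ^ 6 ≠ 1 := by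
    have hJ := isNonsingularForm_pointForm ℂ 4 6 (AlgPoints.map (toBaseSpz ℂ 4 6 pencilSpz) t)
    change SmoothHypersurface.IsNonsingularForm ℂ (pointFormSpz ℂ 4 6 pencilSpz t) at hJ
    rw [hform, form_eq_dworkFamilyForm] at hJ
    exact (isNonsingularForm_dworkFamilyForm_one_iff (n := 4) (by norm_num)).mp hJ
  refine ⟨ψ, hψ, ?_⟩
  rw [← pointOfFormSpz_pointFormSpz ℂ 4 6 pencilSpz t]
  exact pointOfFormSpz_eq_of_eq ℂ 4 6 pencilSpz _ _ _ _ _ _ hev.symm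

/-! ### §2 The pencil is a smooth projective family; its fibres are the `X_ψ` -/

/-- The pencil is a smooth projective family of relative dimension `4`. [cite: Katz2009, §3]
[cite: VoisinHodgeII2003, §6.2.1] -/
theorem isSmoothProjectiveFamily_pencil : IsSmoothProjectiveFamily pencil 4 :=
  isSmoothProjectiveFamily_familySpz ℂ 4 6 pencilSpz (by norm_num) (by norm_num)

/-- **The projection of a fibre of the pencil to `ℙ⁵`**: `𝒳_t → 𝒳 → 𝒴_U → ℙ⁵_ℂ`.
[cite: VoisinHodgeII2003, §6.2.1] -/
abbrev pencilFiberToProjectiveSpace (t : AlgPoints (baseSpz ℂ 4 6 pencilSpz) ℂ) :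
    fiberOver pencil t ⟶ Motives.projectiveSpace (4 + 1) ℂ :=
  fiberι pencil t ≫ totalSpzToTotal ℂ 4 6 pencilSpz ≫ UniversalHypersurface.toProjectiveSpace ℂ 4 6

/-- **The fibre of the pencil over `t ∈ D(ℂ)` is the hypersurface `X_{F_t}` of its form, compatibly with the
embeddings into `ℙ⁵`** (base change of the universal fibre, `exists_fiberIso_comp_hypersurfaceι`).
[cite: VoisinHodgeII2003, §6.2.1] -/
theorem exists_fiberIso_pencil (t : AlgPoints (baseSpz ℂ 4 6 pencilSpz) ℂ) :
    ∃ e : fiberOver pencil t ≅ SmoothHypersurface.hypersurface (pointFormSpz ℂ 4 6 pencilSpz t),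
      e.hom ≫ SmoothHypersurface.hypersurfaceι (pointFormSpz ℂ 4 6 pencilSpz t) =
        pencilFiberToProjectiveSpace t := by
  obtain ⟨e, he⟩ := exists_fiberIso_comp_hypersurfaceι ℂ 4 6 (by norm_num)
    (AlgPoints.map (toBaseSpz ℂ 4 6 pencilSpz) t)
  refine ⟨fiberOverFamilyPullbackIso (family ℂ 4 6) (toBaseSpz ℂ 4 6 pencilSpz) t ≪≫ e, ?_⟩
  calc (fiberOverFamilyPullbackIso (family ℂ 4 6) (toBaseSpz ℂ 4 6 pencilSpz) t ≪≫ e).hom ≫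
        SmoothHypersurface.hypersurfaceι (pointFormSpz ℂ 4 6 pencilSpz t)
      = (fiberOverFamilyPullbackIso (family ℂ 4 6) (toBaseSpz ℂ 4 6 pencilSpz) t).hom ≫ e.hom ≫
          SmoothHypersurface.hypersurfaceι (pointForm ℂ 4 6 (AlgPoints.map (toBaseSpz ℂ 4 6 pencilSpz) t)) :=
        Category.assoc _ _ _
    _ = (fiberOverFamilyPullbackIso (family ℂ 4 6) (toBaseSpz ℂ 4 6 pencilSpz) t).hom ≫
          fiberι (family ℂ 4 6) (AlgPoints.map (toBaseSpz ℂ 4 6 pencilSpz) t) ≫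
            UniversalHypersurface.toProjectiveSpace ℂ 4 6 := by rw [he]
    _ = ((fiberOverFamilyPullbackIso (family ℂ 4 6) (toBaseSpz ℂ 4 6 pencilSpz) t).hom ≫
          fiberι (family ℂ 4 6) (AlgPoints.map (toBaseSpz ℂ 4 6 pencilSpz) t)) ≫
            UniversalHypersurface.toProjectiveSpace ℂ 4 6 := (Category.assoc _ _ _).symm
    _ = (fiberι (familyPullback.snd (family ℂ 4 6) (toBaseSpz ℂ 4 6 pencilSpz)) t ≫
          familyPullback.fst (family ℂ 4 6) (toBaseSpz ℂ 4 6 pencilSpz)) ≫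
            UniversalHypersurface.toProjectiveSpace ℂ 4 6 := by
        rw [fiberOverFamilyPullbackIso_hom_fiberι]
    _ = pencilFiberToProjectiveSpace t := Category.assoc _ _ _

/-- The same with the form prescribed by an equation `F_t = G` (e.g. `G = F_ψ` at `t = [F_ψ]`).
[cite: VoisinHodgeII2003, §6.2.1] -/
theorem exists_fiberIso_pencil_of_eq (t : AlgPoints (baseSpz ℂ 4 6 pencilSpz) ℂ)
    {G : MvPolynomial (Fin (4 + 2)) ℂ} (hG : pointFormSpz ℂ 4 6 pencilSpz t = G) :
    ∃ e : fiberOver pencil t ≅ SmoothHypersurface.hypersurface G,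
      e.hom ≫ SmoothHypersurface.hypersurfaceι G = pencilFiberToProjectiveSpace t := by
  subst hG
  exact exists_fiberIso_pencil t

/-- **The fibre of the pencil over `[F_ψ]` is `X_ψ`**, compatibly with the embeddings into `ℙ⁵`.
[cite: Katz2009, §3] [cite: VoisinHodgeII2003, §6.2.1] -/
theorem exists_fiberIso_pencilPoint (hψ : ψ ^ 6 ≠ 1) :
    ∃ e : fiberOver pencil (pencilPoint hψ) ≅ fibre ψ,
      e.hom ≫ SmoothHypersurface.hypersurfaceι (form ψ) = pencilFiberToProjectiveSpace (pencilPoint hψ) :=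
  exists_fiberIso_pencil_of_eq _ (pointFormSpz_pencilPoint hψ)

/-! ### §3 Ehresmann: the pencil is homotopically locally trivial over all of `D(ℂ)` -/

/-- The base `D = 𝔸¹ ∖ μ₆` (indeed any `S_φ ⊆ 𝔸^ι`, `ι` finite) is quasi-compact: an open subset of the
Noetherian space `Spec ℂ[b]` (Hartshorne II Ex. 2.13 (b)). [cite: Hartshorne1977, II Ex. 2.13] -/
theorem compactSpace_baseSpz_left {ι : Type} [Finite ι] (φ : CoeffRing ℂ 4 6 →ₐ[ℂ] MvPolynomial ι ℂ) :
    CompactSpace (baseSpz ℂ 4 6 φ).left := by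
  haveI : Fintype ι := Fintype.ofFinite ι
  change CompactSpace (baseSpzOpens ℂ 4 6 φ : Set (Spec (CommRingCat.of (MvPolynomial ι ℂ))))
  exact isCompact_iff_compactSpace.mp (TopologicalSpace.NoetherianSpace.isCompact _)

/-- **Ehresmann for the Dwork pencil**: every point of `D(ℂ)` has arbitrarily small open neighbourhoods
`B` over which each fibre inclusion `𝒳_t(ℂ) ↪ π⁻¹B(ℂ)`, `t ∈ B`, underlies a homotopy equivalence
(Voisin I Thm. 9.3, §9.2.1; the tree's `isHomotopicallyLocallyTrivialOn_univ` for the smooth proper family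
`π` over the smooth separated quasi-compact curve `D`). [cite: VoisinHodgeI2002, Thm. 9.3 and §9.2.1] -/
theorem isHomotopicallyLocallyTrivialOn_pencil :
    IsHomotopicallyLocallyTrivialOn pencil (Set.univ : Set (ComplexPoints (baseSpz ℂ 4 6 pencilSpz))) := by
  haveI := isSmoothProjectiveFamily_pencil.smoothOfRelativeDimension
  haveI := isSmoothProjectiveFamily_pencil.isProper
  haveI := smoothOfRelativeDimension_baseSpz_hom ℂ 4 6 pencilSpz
  haveI := locallyOfFiniteType_baseSpz_hom ℂ 4 6 pencilSpz
  haveI := isSeparated_baseSpz_hom ℂ 4 6 pencilSpz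
  haveI := compactSpace_baseSpz_left pencilSpz
  exact isHomotopicallyLocallyTrivialOn_univ pencil 4 (0 + Nat.card Unit)

/-- Hence `R⁴π_*ℂ` (indeed every `Rᵏπ_*ℂ`) of the pencil is a local system on `D(ℂ)`: over small open
`B ⊆ D(ℂ)` restriction `Hᵏ(π⁻¹B(ℂ); ℂ) → Hᵏ(𝒳_t(ℂ); ℂ)` is bijective for all `t ∈ B`.
[cite: VoisinHodgeI2002, §9.2.1] -/
theorem isCohomologicallyLocallyTrivialOn_pencil :
    IsCohomologicallyLocallyTrivialOn pencil (Set.univ : Set (ComplexPoints (baseSpz ℂ 4 6 pencilSpz))) :=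
  isHomotopicallyLocallyTrivialOn_pencil.isCohomologicallyLocallyTrivialOn

end Literature.AlgebraicGeometry.HodgeTheory.DworkSextic

end
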